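import Summits.AtomisticToContinuum.HydrodynamicLimit.Theorems.MourreKoopmanChargesStressStrongMixingTwoTimeClustering
import Literature.MathematicalPhysics.StatisticalMechanics.LowActivityHardSphereGibbsUniqueness
import HarnessLib

/-!
# `StressStrongMixing` · line `birth`, stub F3static `stub_staticClustering`, part 3:
# truncation of an observable (clamping) and locality of the cell observables

Support file for the crux item stmt-AtomisticToContinuum-9584 (`StressStrongMixing`, route `MourreKoopmanCharges` of
`AtomisticToContinuum/HydrodynamicLimit`), line `birth`, registered stub `stub_staticClustering` (F3static).

* **Clamping** `clamp_K t = max (-K) (min t K)` (bounded by `K`): `(t - clamp_K t)² ≤ t⁴/K²`, hence for an observable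
  `a` with a finite fourth moment `E[(a - clamp_K a)²] ≤ E[a⁴]/K²` and, by Cauchy–Schwarz for the covariance,
  `|Cov(a - clamp_K a, B)| ≤ (E a⁴)^{1/2} (E B²)^{1/2} / K` for every `B ∈ L²` (`abs_cov_sub_clamp_le`);
* **locality of the cell observables**: a cell observable `A_h = Σ_{q ∈ [0,1)³} h(v)` only sees the window
  `[0,1)³ × ℝ³ ⊆ B(0, 4) × ℝ³`, so `A_h ∘ (·|_{B(0,k) × ℝ³}) = A_h` for `k ≥ 4` (`cellObs_restrict_window_ball`), and its
  translate `A_h ∘ τ_x` only sees `([0,1)³ - x) × ℝ³`, which misses `B(0, R) × ℝ³` once `R + 4 ≤ ‖x‖`: it is frozen under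
  the superposition of thrown points in `B(0, R)` with any boundary condition
  (`cellObs_spatialShift_superposeIn_ball`) — the two structural inputs of the `φ`-mixing bound
  `abs_cov_le_of_isHardSphereGibbs`.

References: H. Spohn, *Large Scale Dynamics of Interacting Particles* (1991), Part I §7.1 (7.2)–(7.3), Part II §2.2.
-/

noncomputable section

open MeasureTheory ProbabilityTheory Filter Topology
open scoped ENNReal

namespace Summit.AtomisticToContinuum.HydrodynamicLimit.Theorems.MourreKoopmanChargesStressStrongMixing

open Literature.MathematicalPhysics.KineticTheory Literature.Analysis.FluidPDE
open Literature.Analysis.FunctionSpaces (PointConfig)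
open Literature.MathematicalPhysics.StatisticalMechanics.HardSphere (window)
open Summit.AtomisticToContinuum.HydrodynamicLimit.Theorems.KiferCompactification (mem_superposeIn_iff)

/-! ### Clamping an observable with a finite fourth moment -/

section Clamp

/-- **The clamping error is controlled by the fourth power**: `(t - clamp_K t)² ≤ t⁴ / K²` (`K > 0`): the error
vanishes unless `|t| ≥ K`, where it is at most `|t| ≤ t²/K`. [folklore] -/
theorem sq_sub_clamp_le {K : ℝ} (hK : 0 < K) (t : ℝ) : (t - max (-K) (min t K)) ^ 2 ≤ t ^ 4 / K ^ 2 := by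
  rw [le_div_iff₀ (pow_pos hK 2)]
  rcases le_total t K with htK | hKt
  · rw [min_eq_left htK]
    rcases le_total (-K) t with hKt' | htK'
    · rw [max_eq_right hKt', sub_self, zero_pow two_ne_zero, zero_mul]
      positivity
    · rw [max_eq_left htK']
      have h1 : (t - -K) ^ 2 ≤ t ^ 2 := by nlinarith
      have h2 : K ^ 2 ≤ t ^ 2 := by nlinarith
      calc (t - -K) ^ 2 * K ^ 2 ≤ t ^ 2 * t ^ 2 := mul_le_mul h1 h2 (sq_nonneg K) (sq_nonneg t)
        _ = t ^ 4 := by ring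
  · rw [min_eq_right hKt, max_eq_right (by linarith : -K ≤ K)]
    have h1 : (t - K) ^ 2 ≤ t ^ 2 := by nlinarith
    have h2 : K ^ 2 ≤ t ^ 2 := by nlinarith
    calc (t - K) ^ 2 * K ^ 2 ≤ t ^ 2 * t ^ 2 := mul_le_mul h1 h2 (sq_nonneg K) (sq_nonneg t)
      _ = t ^ 4 := by ring

/-- The clamp of a measurable function is measurable. [folklore] -/
theorem measurable_clamp {Ω : Type*} [MeasurableSpace Ω] {a : Ω → ℝ} (ha : Measurable a) (K : ℝ) :
    Measurable fun ω => max (-K) (min (a ω) K) :=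
  measurable_const.max (ha.min measurable_const)

variable {Ω : Type*} [MeasurableSpace Ω] {μ : Measure Ω}

/-- **The clamping error is square integrable** when `a⁴ ∈ L¹`, with `E[(a - clamp_K a)²] ≤ E[a⁴]/K²`. [folklore] -/
theorem memLp_two_sub_clamp_and_integral_sq_le {a : Ω → ℝ} (ham : Measurable a)
    (ha4 : Integrable (fun ω => a ω ^ 4) μ) {K : ℝ} (hK : 0 < K) :
    MemLp (fun ω => a ω - max (-K) (min (a ω) K)) 2 μ ∧
      ∫ ω, (a ω - max (-K) (min (a ω) K)) ^ 2 ∂μ ≤ (∫ ω, a ω ^ 4 ∂μ) / K ^ 2 := by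
  have hXm : Measurable fun ω => a ω - max (-K) (min (a ω) K) := ham.sub (measurable_clamp ham K)
  have hdom : Integrable (fun ω => a ω ^ 4 / K ^ 2) μ := ha4.div_const _
  have hsq : Integrable (fun ω => (a ω - max (-K) (min (a ω) K)) ^ 2) μ :=
    hdom.mono' (hXm.pow_const 2).aestronglyMeasurable (ae_of_all _ fun ω => by
      rw [Real.norm_eq_abs, abs_of_nonneg (sq_nonneg _)]
      exact sq_sub_clamp_le hK (a ω))
  refine ⟨(memLp_two_iff_integrable_sq hXm.aestronglyMeasurable).2 hsq, ?_⟩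
  rw [← integral_div]
  exact integral_mono_of_nonneg (ae_of_all _ fun ω => sq_nonneg _) hdom
    (ae_of_all _ fun ω => sq_sub_clamp_le hK (a ω))

/-- **Covariance of the clamping error** (Cauchy–Schwarz): for measurable `a` with `a⁴ ∈ L¹(μ)`, `B ∈ L²(μ)` and `K > 0`,
`|Cov_μ(a - clamp_K a, B)| ≤ (E a⁴)^{1/2} (E B²)^{1/2} / K`. [folklore] -/
theorem abs_cov_sub_clamp_le [IsProbabilityMeasure μ] {a B : Ω → ℝ} (ham : Measurable a)
    (ha4 : Integrable (fun ω => a ω ^ 4) μ) (hB2 : MemLp B 2 μ) {K : ℝ} (hK : 0 < K) :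
    |cov[fun ω => a ω - max (-K) (min (a ω) K), B; μ]| ≤
      Real.sqrt (∫ ω, a ω ^ 4 ∂μ) * Real.sqrt (∫ ω, B ω ^ 2 ∂μ) / K := by
  obtain ⟨hX2, hXle⟩ := memLp_two_sub_clamp_and_integral_sq_le ham ha4 hK
  have hcs := Literature.Probability.Moments.covariance_sq_le_variance_mul hX2 hB2
  have hVX : Var[fun ω => a ω - max (-K) (min (a ω) K); μ] ≤ (∫ ω, a ω ^ 4 ∂μ) / K ^ 2 :=
    (variance_le_expectation_sq hX2.aestronglyMeasurable).trans hXle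
  have hVB : Var[B; μ] ≤ ∫ ω, B ω ^ 2 ∂μ := variance_le_expectation_sq hB2.aestronglyMeasurable
  have h4 : 0 ≤ ∫ ω, a ω ^ 4 ∂μ := integral_nonneg fun ω => Even.pow_nonneg (by decide : Even 4) (a ω)
  have hB0 : 0 ≤ ∫ ω, B ω ^ 2 ∂μ := integral_nonneg fun ω => sq_nonneg (B ω)
  have hsq : cov[fun ω => a ω - max (-K) (min (a ω) K), B; μ] ^ 2 ≤
      ((∫ ω, a ω ^ 4 ∂μ) / K ^ 2) * ∫ ω, B ω ^ 2 ∂μ :=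
    hcs.trans (mul_le_mul hVX hVB (variance_nonneg _ _) (div_nonneg h4 (sq_nonneg K)))
  calc |cov[fun ω => a ω - max (-K) (min (a ω) K), B; μ]|
      = Real.sqrt (cov[fun ω => a ω - max (-K) (min (a ω) K), B; μ] ^ 2) := (Real.sqrt_sq_eq_abs _).symm
    _ ≤ Real.sqrt (((∫ ω, a ω ^ 4 ∂μ) / K ^ 2) * ∫ ω, B ω ^ 2 ∂μ) := Real.sqrt_le_sqrt hsq
    _ = Real.sqrt (∫ ω, a ω ^ 4 ∂μ) * Real.sqrt (∫ ω, B ω ^ 2 ∂μ) / K := by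
        rw [Real.sqrt_mul (div_nonneg h4 (sq_nonneg K)), Real.sqrt_div h4, Real.sqrt_sq hK.le]
        ring

end Clamp

/-! ### Locality of the cell observables -/

section Locality

/-- The unit cell lies in the ball `B(0, 4)` (its points have norm `≤ 3`). [folklore] -/
theorem unitCell_subset_ball_four : unitCell ⊆ Metric.ball (0 : V3) 4 := fun q hq => by
  rw [Metric.mem_ball, dist_zero_right]
  linarith [norm_le_of_mem_unitCell hq]

/-- Points of the translated cell `[0,1)³ - x` stay outside `B(0, R)` once `R + 4 ≤ ‖x‖`. [folklore] -/
theorem sub_notMem_ball_of_mem_unitCell {x : V3} {R : ℝ} (hR : R + 4 ≤ ‖x‖) {q : V3} (hq : q ∈ unitCell) :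
    q - x ∉ Metric.ball (0 : V3) R := by
  rw [Metric.mem_ball, dist_zero_right, not_lt]
  have h3 := norm_le_of_mem_unitCell hq
  have h := norm_sub_norm_le x q
  rw [← norm_neg (x - q), neg_sub] at h
  linarith

/-- **A cell observable only sees the window of the unit cell**: restricting the configuration to `B(0, k) × ℝ³`,
`k ≥ 4`, does not change `A_h`. [folklore] -/
theorem cellObs_restrict_window_ball (h : V3 → ℝ) {k : ℝ} (hk : 4 ≤ k) (ω : MarkedConfig) :
    cellObs h (PointConfig.restrict (window (Metric.ball (0 : V3) k)) ω) = cellObs h ω := by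
  refine isCylinder_cellObs h _ _ (PointConfig.ext fun p => ?_)
  simp only [mem_restrict_iff, Set.mem_prod, Set.mem_univ, and_true,
    Literature.MathematicalPhysics.StatisticalMechanics.HardSphere.mem_window]
  constructor
  · rintro ⟨⟨hp, -⟩, hpu⟩
    exact ⟨hp, hpu⟩
  · rintro ⟨hp, hpu⟩
    exact ⟨⟨hp, Metric.ball_subset_ball hk (unitCell_subset_ball_four hpu)⟩, hpu⟩

/-- **A far translate of a cell observable does not see the particles thrown into `B(0, R)`**: for `R + 4 ≤ ‖x‖`,
`(A_h ∘ τ_x)(superposeIn (B(0,R)) ξ Y) = (A_h ∘ τ_x)(Y)` for all thrown points `ξ` and boundary conditions `Y`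
(`A_h ∘ τ_x` is a cylinder observable of `([0,1)³ - x) × ℝ³ ⊆ (B(0,R) × ℝ³)ᶜ`). [folklore] -/
theorem cellObs_spatialShift_superposeIn_ball (h : V3 → ℝ) {x : V3} {R : ℝ} (hR : R + 4 ≤ ‖x‖) {k : ℕ}
    (ξ : Fin k → V3 × V3) (Y : MarkedConfig) :
    cellObs h (spatialShift x (superposeIn (Metric.ball (0 : V3) R) ξ Y)) = cellObs h (spatialShift x Y) := by
  refine isCylinder_cellObs h _ _ (PointConfig.ext fun p => ?_)
  simp only [spatialShift_apply, ← PointConfig.mem_carrier, PointConfig.carrier_restrict, PointConfig.carrier_translate,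
    Set.mem_inter_iff, Set.mem_image, Set.mem_prod, Set.mem_univ, and_true]
  have key : ∀ q : V3 × V3, (q + (x, (0 : V3))).1 ∈ unitCell → q.1 ∉ Metric.ball (0 : V3) R := fun q hq => by
    have h' := sub_notMem_ball_of_mem_unitCell hR hq
    simpa only [Prod.fst_add, add_sub_cancel_right] using h'
  constructor
  · rintro ⟨⟨q, hq, rfl⟩, hpu⟩
    rcases (mem_superposeIn_iff _ ξ Y q).1 hq with ⟨-, hqΛ⟩ | ⟨hqY, -⟩
    · exact absurd hqΛ (key q hpu)
    · exact ⟨⟨q, hqY, rfl⟩, hpu⟩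
  · rintro ⟨⟨q, hqY, rfl⟩, hpu⟩
    exact ⟨⟨q, (mem_superposeIn_iff _ ξ Y q).2 (Or.inr ⟨hqY, key q hpu⟩), rfl⟩, hpu⟩

/-- Every generator is a cell observable `cellObs h` of a measurable one-body function. [folklore] -/
theorem exists_eq_cellObs_of_mem_generators {a : MarkedConfig → ℝ}
    (ha : a ∈ Set.range cellCharge ∪ {cellObs fun v : V3 => v 0 * v 1}) :
    ∃ h : V3 → ℝ, Measurable h ∧ a = cellObs h := by
  rcases ha with ⟨i, rfl⟩ | ha
  · exact ⟨chargeFn i, (continuous_chargeFn i).measurable, rfl⟩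
  · rw [Set.mem_singleton_iff.1 ha]
    exact ⟨fun v : V3 => v 0 * v 1, (show Continuous fun v : V3 => v 0 * v 1 by fun_prop).measurable, rfl⟩

/-- **Locality of the generators, inside form**: every generator `a` satisfies `a ∘ (·|_{B(0,4) × ℝ³}) = a`, and so does
its clamp. [folklore] -/
theorem clamp_restrict_window_ball_of_mem_generators {a : MarkedConfig → ℝ}
    (ha : a ∈ Set.range cellCharge ∪ {cellObs fun v : V3 => v 0 * v 1}) (K : ℝ) (ω : MarkedConfig) :
    max (-K) (min (a (PointConfig.restrict (window (Metric.ball (0 : V3) 4)) ω)) K) = max (-K) (min (a ω) K) := by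
  obtain ⟨h, -, rfl⟩ := exists_eq_cellObs_of_mem_generators ha
  rw [cellObs_restrict_window_ball h le_rfl]

/-- **Locality of the generators, outside form**: for a generator `b` and `R + 4 ≤ ‖x‖`, the translate `b ∘ τ_x` is
frozen under the superposition of thrown points in `B(0, R)`. [folklore] -/
theorem comp_spatialShift_superposeIn_ball_of_mem_generators {b : MarkedConfig → ℝ}
    (hb : b ∈ Set.range cellCharge ∪ {cellObs fun v : V3 => v 0 * v 1}) {x : V3} {R : ℝ} (hR : R + 4 ≤ ‖x‖)
    (n : ℕ) (ξ : Fin n → V3 × V3) (Y : MarkedConfig) :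
    (b ∘ spatialShift x) (superposeIn (Metric.ball (0 : V3) R) ξ Y) = (b ∘ spatialShift x) Y := by
  obtain ⟨h, -, rfl⟩ := exists_eq_cellObs_of_mem_generators hb
  exact cellObs_spatialShift_superposeIn_ball h hR ξ Y

/-- **Registered helper stub (part 3 of `stub_staticClustering`)**: far translates of the generators are cylinder
functions of the complement of a ball (`comp_spatialShift_superposeIn_ball_of_mem_generators` in closed form).
[folklore] -/
theorem staticClustering_generatorLocality : ∀ (b : MarkedConfig → ℝ), b ∈ Set.range cellCharge ∪ {cellObs fun v : V3 => v 0 * v 1} → ∀ (x : V3) (R : ℝ), R + 4 ≤ ‖x‖ → ∀ (n : ℕ) (ξ : Fin n → V3 × V3) (Y : MarkedConfig), (b ∘ spatialShift x) (superposeIn (Metric.ball (0 : V3) R) ξ Y) = (b ∘ spatialShift x) Y :=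
  fun _b hb _x _R hR n ξ Y => comp_spatialShift_superposeIn_ball_of_mem_generators hb hR n ξ Y

end Locality

end Summit.AtomisticToContinuum.HydrodynamicLimit.Theorems.MourreKoopmanChargesStressStrongMixing

end
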